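import Summits.QuantumFields.BalabanUV.Beta.GAN24.LambdaMemberPairing

/-!
# `BalabanUV.Beta.GAN24.LambdaSectorSlotSum` — binder row G-an2-4 ∕ (CONV-C), the (S) row ∕ (W-γ) one level up, the (ζ-Λ) step:
# **THE LAGRANGE SECTOR OF THE SOURCE PAIRING, UNFOLDED AT EVERY LEVEL — `X^{Λ}_{j+1}(h; n, φ) = −cH_j·Σ'_Y Σ_μ T_j(μ,Y)·(Σ'_{u′} Σ_κ′ (H_j h)(κ′,u′)·lamCoeffK_j μ Y κ′ u′)`**
# (G-an2-4 CRUX TEAM (2), seat `b2b-balaban-gan24-formalise-leaf-06` = the (γ) hand, gen 50, INTENT 1, PART A2)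

NOT IN PRINT; OUR BOOKKEEPING ([folklore] Fubini bookkeeping BY NAME over leaf-02 g61's PART 3 `CubicPushGaugeLegUnfoldingFF.hasSum_prod_gaugeLeg_e3OfK_ff` read through
TODAY's `CubicSectorLevelDown.slotSum_gaugeLeg_e3OfK_ff` (slot sum done), an1's `AveragingHessianKernelsRooted.biLoc_hessFFAt` ∕ leaf-06 FILE A's finite-support bookkeeping
`CombFreeGaugeLegCharges.hasSum_prod_of_support`, node 7a's `InterLevelTransport.locStencil_SLam` and `BalabanStepJetsSucc.abs_lamCoeffK_le`; 0 `def`, 0 cited fact, 0 `def … : Prop`,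
0 sorry).
HONEST FRAMING (cell contract, verbatim): «discharging `BetaPertH` makes Bałaban's UV stability UNCONDITIONAL — a real constructive-QFT result; it is NOT the continuum limit and NOT
the Clay problem.»  HONEST DEPENDENCY (verbatim): «continuum YM on T⁴ ⇐ BetaPertH ∧ nine spine estimates (0/9 proved); BetaPertH ⇐ (D1) ∧ (D4) ∧ CAP+tail; G-an2-4 gates asym,
D1 and NE2/3/4.»

WHY.  The Λ member of `SrecAt j` is `(cΛ·wΛ_j) • SΛ_j`, `SΛ_j κ′ u′ = SLam Lc (lamCoeffK (KInvStep Lc j) (E2 j) Lc) (hessFFAt ρ Lc) κ′ u′ = −Σ_μ Σ'_Y lamCoeffK_j μ Y κ′ u′ • hessFFAt ρ Lc μ Y`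
(weight stripped here).  It has no multiplier rows, so `CubicSectorLevelDown.slotSum_gaugeLeg_e3OfK_ff` gives `X^{Λ}_{j+1}(h; n, φ) = cH_j·Σ_κ′ Σ'_{u′} (H_j h)(κ′,u′)·I_Λ(κ′,u′)` with the
inner pairing `I_Λ(κ′,u′) = Σ'_{(y,w)} Σ_κ″ Σ_a (H_j n)(κ″,y)·dz(φ∘blk) a w·SΛ_j κ′ u′ y w (inl κ″)(inl a)`.  THIS FILE computes `I_Λ` (§2): an1's table `hessFFAt ρ Lc μ Y` is supported on
`nearBox Lc Y × nearBox Lc Y`, so its two-leg pairing against `(H_j n, dz(φ∘blk))` is the ITERATED table `T_j(μ,Y) = Σ'_y Σ_κ″ (H_j n)(κ″,y)·(Σ'_w Σ_a hessFFAt ρ Lc μ Y y w (inl κ″)(inl a)·dz(φ∘blk) a w)`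
of (β) ∕ (δ2b) §3 ∕ (ε-Λ) §3 — and the `Y`-superposition commutes with the pair sum (the conversion coefficients decay from `Lc•Y`, the table is bi-localised there):
`I_Λ(κ′,u′) = −Σ_μ Σ'_Y lamCoeffK_j μ Y κ′ u′·T_j(μ,Y)`.  One more Fubini step `(u′, Y)` (§3) puts the slot weights of (ε-Λ) §2 inside:
`X^{Λ}_{j+1}(h; n, φ) = −cH_j·Σ'_Y Σ_μ T_j(μ,Y)·(Σ'_{u′} Σ_κ′ (H_j h)(κ′,u′)·lamCoeffK_j μ Y κ′ u′)` — every `j`, in-block root, `h` summable along every direction, bounded `n`, bounded `φ`.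
The sequel `LambdaSectorSourcePairingZero` (PART B) inserts (ε-Λ) §2 (the weights are `−σ_j·stepScale_j⁻¹·(C_j h)(μ,Y)`, centred root) and (ε-Λ) §3 (two-level `h`, periodic `n`,
block label: the Λ-sector VANISHES), and bridges the level-0 literal `lamCoeffOf (KInv Lc) Lc` of `S0NAt`.
* (PART A1 `LambdaMemberPairing`: the member is local without multiplier rows, its coefficients decay; the table pairs as the iterated `T_j`, uniformly bounded; coarse
  exponential sums by road-P2's `KernelLegCharges.summable_exp_coarse`.)
* §2 **`innerPairing_SLam_eq`** — the inner pairing of the member.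
* §3 **`lambdaSector_slotSum_eq`** — the statement in the title.
Asserts NO value of any resolvent column; NOTHING of (C2′) beyond (δ2b) ∕ `hX` ∕ (W-γ) at levels ≥ 1 ∕ (INV) ∕ (S) discharged; NEVER «G-an2-4 closed» as (CONV-C); NOT D1, NOT `BetaPertH`,
NOT continuum, NOT Clay.  2026-08-23; no existing file touched.
-/

noncomputable section

open Finset
open scoped BigOperators
open Literature.MathematicalPhysics.QuantumFieldTheory
open Literature.MathematicalPhysics.QuantumFieldTheory.Balaban1983to89
open Literature.MathematicalPhysics.QuantumFieldTheory.Balaban1983to89.Beta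
open B12Sec2to5 (l1 l1_nonneg)
open ExpKernelCalculus (Site MKer BiLoc Decays Zl Zl_nonneg summable_exp_shift summable_exp_shift' tsum_exp_shift' l1_sub_symm VertexFamily)
open OneStepResolventKernel (Fib LocStencil decays_mono)
open AffineAveraging (Form0 Form1 box toSite unitVec dz)
open AveragingContours (blk)
open AveragingHessianKernels (ell)
open AveragingHessianKernelsRooted (hessFFAt hessFFAt_inr biLoc_hessFFAt)
open InterLevelTransport (SLam cwsum cwsum_apply locStencil_SLam)
open OneStepKernelFamily (KInvStep colH decays_KInvStep)
open BalabanStepJetsSucc (E2 lamCoeffK abs_lamCoeffK_le decays_E2)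
open Summit.QuantumFields.BalabanUV.Beta.AxialDressingRooted (coDressKBmAt decays_coDressKBmAt one_le_of_neZero)
open Summit.QuantumFields.BalabanUV.Beta.BorderedHessian (stepScale)
open Summit.QuantumFields.BalabanUV.Beta.SpineRooted (e3OfK)
open Summit.QuantumFields.BalabanUV.Beta.LinearGaugeVH (nearBox mem_nearBox summable_of_finsupp)
open Summit.QuantumFields.BalabanUV.Beta.GAN24.ResolventLegCharges (tsum_exp_coarse_le')
open Summit.QuantumFields.BalabanUV.Beta.GAN24.CoarseGaugeSourceResponse (summable_bdd_mul)
open Summit.QuantumFields.BalabanUV.Beta.GAN24.CombFreeGaugeLegCharges (hasSum_prod_of_support hessFFAt_inl_inl_eq_zero_of_not_mem₂)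
open Summit.QuantumFields.BalabanUV.Beta.GAN24.CubicPushGaugeLegUnfoldingFF (abs_fieldResponse_le')
open Summit.QuantumFields.BalabanUV.Beta.GAN24.CubicSectorLevelDown (summable_fieldResponse slotSum_gaugeLeg_e3OfK_ff)

open Summit.QuantumFields.BalabanUV.Beta.GAN24.KernelLegCharges (summable_exp_coarse)
open Summit.QuantumFields.BalabanUV.Beta.GAN24.LambdaMemberPairing (SLam_hessFFAt_inr_inl_eq_zero locStencil_SLam_lamCoeffK exists_abs_lamCoeffK_le
  tsum_prod_hessFFAt_pairing_eq_iterated abs_hessFFAt_pairing_summand_le abs_lambdaTable_le)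

namespace Summit.QuantumFields.BalabanUV.Beta.GAN24.LambdaSectorSlotSum

variable {d : ℕ}

section Step

variable {Lc : ℕ} [NeZero Lc] {r : Fin (d + 1) → ℕ}

/-! ## §2 The inner pairing of the Lagrange member -/

/-- NOT IN PRINT; OUR BOOKKEEPING.  **THE INNER PAIRING OF THE LAGRANGE MEMBER** (every `j`, in-block root `ρ = toSite r`, every stencil slot `(κ′, u′)`, bounded `n`, bounded `φ`;
`H_j n (κ″,y) = Σ_κ Σ'_u n κ u·colH G_j Lc κ u κ″ y`, `lamCoeffK_j = lamCoeffK (KInvStep Lc j) (E2 j) Lc`):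
`Σ'_{(y,w)} Σ_κ″ Σ_a (H_j n)(κ″,y)·dz(φ∘blk) a w·SLam Lc lamCoeffK_j (hessFFAt ρ Lc) κ′ u′ y w (inl κ″)(inl a) = −Σ_μ Σ'_Y lamCoeffK_j μ Y κ′ u′·T_j(μ,Y)`
— the `Y`-superposition of the member commutes with the pair sum (coefficients decay from `Lc•Y`, the table is bi-localised there: an absolutely summable family on `(Site × Site) × Site`),
and per `(μ, Y)` the pair sum is the iterated table (finite support). -/
theorem innerPairing_SLam_eq (hr : r ∈ box (d + 1) Lc) (j : ℕ) {n : Form1 (d + 1) ℝ} {Bn : ℝ} (hn : ∀ κ u, |n κ u| ≤ Bn)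
    {φ : Site (d + 1) → ℝ} {Bφ : ℝ} (hφ : ∀ y, |φ y| ≤ Bφ) (κ' : Fin (d + 1)) (u' : Site (d + 1)) :
    ∑' yw : Site (d + 1) × Site (d + 1), ∑ κ'' : Fin (d + 1), ∑ a : Fin (d + 1),
        (∑ κ, ∑' u : Site (d + 1), n κ u * colH (coDressKBmAt (toSite r) Lc (KInvStep (d := d) Lc j)) Lc κ u κ'' yw.1)
          * dz (fun x => φ (blk Lc x)) a yw.2
          * SLam Lc (lamCoeffK (KInvStep (d := d) Lc j) (E2 d Lc j) Lc) (fun μ y => hessFFAt (toSite r) Lc μ y) κ' u' yw.1 yw.2 (Sum.inl κ'') (Sum.inl a)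
      = -∑ μ : Fin (d + 1), ∑' Y : Site (d + 1), lamCoeffK (KInvStep (d := d) Lc j) (E2 d Lc j) Lc μ Y κ' u' *
          ∑' y : Site (d + 1), ∑ κ'' : Fin (d + 1),
            (∑ κ, ∑' u : Site (d + 1), n κ u * colH (coDressKBmAt (toSite r) Lc (KInvStep (d := d) Lc j)) Lc κ u κ'' y)
              * (∑' w : Site (d + 1), ∑ a : Fin (d + 1), hessFFAt (toSite r) Lc μ Y y w (Sum.inl κ'') (Sum.inl a) * dz (fun x => φ (blk Lc x)) a w) := by
  classical
  set G : MKer (d + 1) (Fib d) := coDressKBmAt (toSite r) Lc (KInvStep (d := d) Lc j) with hGdef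
  set Hn : Fin (d + 1) → Site (d + 1) → ℝ := fun κ'' y => ∑ κ, ∑' u : Site (d + 1), n κ u * colH G Lc κ u κ'' y with hHn
  set Φ : Site (d + 1) → ℝ := fun x => φ (blk Lc x) with hΦ
  set lam : Fin (d + 1) → Site (d + 1) → ℝ := fun μ Y => lamCoeffK (KInvStep (d := d) Lc j) (E2 d Lc j) Lc μ Y κ' u' with hlam
  -- bounds
  obtain ⟨BH, hBH0, hHb⟩ := abs_fieldResponse_le' (d := d) hr j hn
  have hBφ : 0 ≤ Bφ := (abs_nonneg _).trans (hφ 0)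
  have hgb : ∀ a w, |dz Φ a w| ≤ 2 * Bφ := KKTFluctuationEnergy.abs_dz_le (fun x => hφ (blk Lc x))
  obtain ⟨Cl, δl, hδl, hCl, hlamb⟩ := exists_abs_lamCoeffK_le (d := d) (Lc := Lc) j
  set M : ℝ := ((d + 1 : ℕ) : ℝ) * (((d + 1 : ℕ) : ℝ) * (BH * (2 * Bφ) * (2 * (ell (d + 1) Lc : ℝ) ^ 2 * Real.exp (4 * ((d : ℝ) + 1) * Lc * 1)))) with hM
  have hM0 : 0 ≤ M := by positivity
  -- the pair summand per `(μ, Y)` and its majorant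
  set B : Fin (d + 1) → Site (d + 1) → Site (d + 1) × Site (d + 1) → ℝ := fun μ Y yw => ∑ κ'' : Fin (d + 1), ∑ a : Fin (d + 1),
      Hn κ'' yw.1 * dz Φ a yw.2 * hessFFAt (toSite r) Lc μ Y yw.1 yw.2 (Sum.inl κ'') (Sum.inl a) with hB
  have hBle : ∀ μ Y yw, |B μ Y yw| ≤ M * (Real.exp (-1 * l1 (yw.1 - (Lc : ℤ) • Y)) * Real.exp (-1 * l1 (yw.2 - (Lc : ℤ) • Y))) :=
    fun μ Y yw => abs_hessFFAt_pairing_summand_le hr μ Y (A := Hn) hHb hgb yw.1 yw.2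
  -- summability in `Y` of each entry family (decaying coefficient × bounded table entry)
  have hslam : ∀ μ, Summable fun Y : Site (d + 1) => lam μ Y := fun μ =>
    Summable.of_norm_bounded ((summable_exp_coarse (d := d) (one_le_of_neZero Lc) hδl u').mul_left Cl) (fun Y => by rw [Real.norm_eq_abs]; exact hlamb μ Y κ' u')
  have hsY : ∀ (μ κ'' a : Fin (d + 1)) (yw : Site (d + 1) × Site (d + 1)),
      Summable fun Y : Site (d + 1) => lam μ Y * (Hn κ'' yw.1 * dz Φ a yw.2 * hessFFAt (toSite r) Lc μ Y yw.1 yw.2 (Sum.inl κ'') (Sum.inl a)) := by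
    intro μ κ'' a yw
    have hb : ∀ Y, |Hn κ'' yw.1 * dz Φ a yw.2 * hessFFAt (toSite r) Lc μ Y yw.1 yw.2 (Sum.inl κ'') (Sum.inl a)|
        ≤ BH * (2 * Bφ) * (2 * (ell (d + 1) Lc : ℝ) ^ 2 * Real.exp (4 * ((d : ℝ) + 1) * Lc * 0)) := by
      intro Y
      have h0 := biLoc_hessFFAt (d := d) (one_le_of_neZero Lc) μ Y hr (δ := 0) le_rfl yw.1 yw.2 (Sum.inl κ'') (Sum.inl a)
      have h0' : |hessFFAt (toSite r) Lc μ Y yw.1 yw.2 (Sum.inl κ'') (Sum.inl a)| ≤ 2 * (ell (d + 1) Lc : ℝ) ^ 2 * Real.exp (4 * ((d : ℝ) + 1) * Lc * 0) := by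
        refine h0.trans (le_of_eq ?_)
        rw [show -(0 : ℝ) * (l1 (yw.1 - (Lc : ℤ) • Y) + l1 (yw.2 - (Lc : ℤ) • Y)) = 0 by ring, Real.exp_zero, mul_one]
      rw [abs_mul, abs_mul]
      exact mul_le_mul (mul_le_mul (hHb κ'' yw.1) (hgb a yw.2) (abs_nonneg _) hBH0) h0' (abs_nonneg _) (by positivity)
    exact (summable_bdd_mul (hslam μ) hb).congr fun Y => by ring
  -- pointwise: the member is the `Y`-superposition
  have hpt : ∀ yw : Site (d + 1) × Site (d + 1), (∑ κ'' : Fin (d + 1), ∑ a : Fin (d + 1), Hn κ'' yw.1 * dz Φ a yw.2 *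
        SLam Lc (lamCoeffK (KInvStep (d := d) Lc j) (E2 d Lc j) Lc) (fun μ y => hessFFAt (toSite r) Lc μ y) κ' u' yw.1 yw.2 (Sum.inl κ'') (Sum.inl a))
      = -∑ μ : Fin (d + 1), ∑' Y : Site (d + 1), lam μ Y * B μ Y yw := by
    intro yw
    set F : Fin (d + 1) → Fin (d + 1) → Fin (d + 1) → Site (d + 1) → ℝ := fun κ'' a μ Y =>
      lam μ Y * (Hn κ'' yw.1 * dz Φ a yw.2 * hessFFAt (toSite r) Lc μ Y yw.1 yw.2 (Sum.inl κ'') (Sum.inl a)) with hFdef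
    have hsF : ∀ κ'' a μ, Summable (F κ'' a μ) := fun κ'' a μ => hsY μ κ'' a yw
    -- unfold the member at the entry `(yw, κ″, a)`
    have e1 : ∀ κ'' a, Hn κ'' yw.1 * dz Φ a yw.2 *
        SLam Lc (lamCoeffK (KInvStep (d := d) Lc j) (E2 d Lc j) Lc) (fun μ y => hessFFAt (toSite r) Lc μ y) κ' u' yw.1 yw.2 (Sum.inl κ'') (Sum.inl a)
        = -∑ μ : Fin (d + 1), ∑' Y : Site (d + 1), F κ'' a μ Y := by
      intro κ'' a
      simp only [SLam, cwsum_apply, hFdef, hlam]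
      rw [mul_neg, Finset.mul_sum, neg_inj]
      refine Finset.sum_congr rfl fun μ _ => ?_
      rw [← tsum_mul_left]
      exact tsum_congr fun Y => by ring
    rw [Finset.sum_congr rfl fun κ'' _ => Finset.sum_congr rfl fun a _ => e1 κ'' a]
    simp only [Finset.sum_neg_distrib, neg_inj]
    -- exchange the finite sums `(κ″, a)` with `(μ, Σ'_Y)`
    have c1 : (∑ κ'' : Fin (d + 1), ∑ a : Fin (d + 1), ∑ μ : Fin (d + 1), ∑' Y : Site (d + 1), F κ'' a μ Y)
        = ∑ μ : Fin (d + 1), ∑ κ'' : Fin (d + 1), ∑ a : Fin (d + 1), ∑' Y : Site (d + 1), F κ'' a μ Y := by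
      calc (∑ κ'' : Fin (d + 1), ∑ a : Fin (d + 1), ∑ μ : Fin (d + 1), ∑' Y : Site (d + 1), F κ'' a μ Y)
          = ∑ κ'' : Fin (d + 1), ∑ μ : Fin (d + 1), ∑ a : Fin (d + 1), ∑' Y : Site (d + 1), F κ'' a μ Y :=
            Finset.sum_congr rfl fun κ'' _ => Finset.sum_comm
        _ = ∑ μ : Fin (d + 1), ∑ κ'' : Fin (d + 1), ∑ a : Fin (d + 1), ∑' Y : Site (d + 1), F κ'' a μ Y := Finset.sum_comm
    rw [c1]
    refine Finset.sum_congr rfl fun μ _ => ?_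
    have c2 : ∀ κ'' : Fin (d + 1), (∑ a : Fin (d + 1), ∑' Y : Site (d + 1), F κ'' a μ Y) = ∑' Y : Site (d + 1), ∑ a : Fin (d + 1), F κ'' a μ Y :=
      fun κ'' => (Summable.tsum_finsetSum (fun a _ => hsF κ'' a μ)).symm
    rw [Finset.sum_congr rfl fun κ'' _ => c2 κ'', ← Summable.tsum_finsetSum (fun κ'' _ => summable_sum fun a _ => hsF κ'' a μ)]
    refine tsum_congr fun Y => ?_
    simp only [hB, hFdef, Finset.mul_sum]
  rw [tsum_congr hpt, tsum_neg]
  -- the absolutely summable family `(yw, Y) ↦ lam μ Y·B μ Y yw`, per `μ`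
  have hF : ∀ μ, Summable (Function.uncurry fun (yw : Site (d + 1) × Site (d + 1)) (Y : Site (d + 1)) => lam μ Y * B μ Y yw) := by
    intro μ
    -- summable in the order `(Y, yw)` by fibres and marginal, then swap
    have h1 : ∀ Y : Site (d + 1), Summable fun yw : Site (d + 1) × Site (d + 1) =>
        Real.exp (-1 * l1 (yw.1 - (Lc : ℤ) • Y)) * Real.exp (-1 * l1 (yw.2 - (Lc : ℤ) • Y)) := fun Y => by
      have h := summable_exp_shift' (D := d + 1) one_pos ((Lc : ℤ) • Y)
      exact h.mul_of_nonneg h (fun _ => (Real.exp_pos _).le) (fun _ => (Real.exp_pos _).le)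
    have h1v : ∀ Y : Site (d + 1), (∑' yw : Site (d + 1) × Site (d + 1),
        Real.exp (-1 * l1 (yw.1 - (Lc : ℤ) • Y)) * Real.exp (-1 * l1 (yw.2 - (Lc : ℤ) • Y))) = Zl (d + 1) 1 * Zl (d + 1) 1 := fun Y => by
      have h := summable_exp_shift' (D := d + 1) one_pos ((Lc : ℤ) • Y)
      have h12 := h.hasSum.mul h.hasSum (h1 Y)
      simp only [tsum_exp_shift'] at h12
      exact h12.tsum_eq
    have hfib : ∀ Y : Site (d + 1), Summable fun yw : Site (d + 1) × Site (d + 1) =>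
        (Cl * Real.exp (-δl * l1 ((Lc : ℤ) • Y - u'))) * (M * (Real.exp (-1 * l1 (yw.1 - (Lc : ℤ) • Y)) * Real.exp (-1 * l1 (yw.2 - (Lc : ℤ) • Y)))) :=
      fun Y => ((h1 Y).mul_left M).mul_left _
    have hmarg : Summable fun Y : Site (d + 1) => ∑' yw : Site (d + 1) × Site (d + 1),
        (Cl * Real.exp (-δl * l1 ((Lc : ℤ) • Y - u'))) * (M * (Real.exp (-1 * l1 (yw.1 - (Lc : ℤ) • Y)) * Real.exp (-1 * l1 (yw.2 - (Lc : ℤ) • Y)))) := by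
      have e : ∀ Y : Site (d + 1), (∑' yw : Site (d + 1) × Site (d + 1),
          (Cl * Real.exp (-δl * l1 ((Lc : ℤ) • Y - u'))) * (M * (Real.exp (-1 * l1 (yw.1 - (Lc : ℤ) • Y)) * Real.exp (-1 * l1 (yw.2 - (Lc : ℤ) • Y)))))
          = (Cl * Real.exp (-δl * l1 ((Lc : ℤ) • Y - u'))) * (M * (Zl (d + 1) 1 * Zl (d + 1) 1)) := fun Y => by
        rw [tsum_mul_left, tsum_mul_left, h1v Y]
      simp only [e]
      exact ((summable_exp_coarse (d := d) (one_le_of_neZero Lc) hδl u').mul_left Cl).mul_right _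
    have hg0 : ∀ q : Site (d + 1) × (Site (d + 1) × Site (d + 1)), 0 ≤ (Cl * Real.exp (-δl * l1 ((Lc : ℤ) • q.1 - u'))) *
        (M * (Real.exp (-1 * l1 (q.2.1 - (Lc : ℤ) • q.1)) * Real.exp (-1 * l1 (q.2.2 - (Lc : ℤ) • q.1)))) := fun q => by positivity
    have hgs : Summable fun q : Site (d + 1) × (Site (d + 1) × Site (d + 1)) => (Cl * Real.exp (-δl * l1 ((Lc : ℤ) • q.1 - u'))) *
        (M * (Real.exp (-1 * l1 (q.2.1 - (Lc : ℤ) • q.1)) * Real.exp (-1 * l1 (q.2.2 - (Lc : ℤ) • q.1)))) :=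
      (summable_prod_of_nonneg hg0).2 ⟨hfib, hmarg⟩
    have hf' : Summable fun q : Site (d + 1) × (Site (d + 1) × Site (d + 1)) => lam μ q.1 * B μ q.1 q.2 := by
      refine Summable.of_norm_bounded hgs (fun q => ?_)
      rw [Real.norm_eq_abs, abs_mul]
      exact mul_le_mul (hlamb μ q.1 κ' u') (hBle μ q.1 q.2) (abs_nonneg _) (by positivity)
    exact hf'.prod_symm
  -- pull the finite `μ`-sum and the `Y`-series out of the pair sum
  have hs_yw : ∀ μ, Summable fun yw : Site (d + 1) × Site (d + 1) => ∑' Y : Site (d + 1), lam μ Y * B μ Y yw := fun μ => by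
    simpa only [Function.uncurry_apply_pair] using (hF μ).prod
  rw [Summable.tsum_finsetSum (fun μ _ => hs_yw μ), neg_inj]
  refine Finset.sum_congr rfl fun μ _ => ?_
  rw [← (hF μ).tsum_comm]
  refine tsum_congr fun Y => ?_
  have h5 : (∑' yw : Site (d + 1) × Site (d + 1), B μ Y yw) = _ := tsum_prod_hessFFAt_pairing_eq_iterated hr μ Y Hn Φ
  rw [tsum_mul_left, h5]

/-! ## §3 The Lagrange sector of the source pairing, slot weights inside -/

/-- NOT IN PRINT; OUR BOOKKEEPING.  **THE LAGRANGE SECTOR OF THE SOURCE PAIRING, UNFOLDED** (every `j`, in-block root `ρ = toSite r`, `h` summable along every direction, bounded `n`,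
bounded `φ`; `cH_j = (stepScale_j·Lc^{d+1})⁻¹`, `H_j h (κ′,u′) = Σ_l Σ'_t h l t·colH G_j Lc l t κ′ u′`, `T_j(μ,Y)` the iterated table of §2):
`Σ_l Σ'_t h l t·Σ'_{(u,x)} Σ_κ Σ_κ₂ n κ u·dzφ κ₂ x·e3OfK Lc G_j (SLam Lc lamCoeffK_j (hessFFAt ρ Lc)) l t u x (inl κ)(inl κ₂)`
`  = −cH_j·Σ'_Y Σ_μ T_j(μ,Y)·(Σ'_{u′} Σ_κ′ (H_j h)(κ′,u′)·lamCoeffK_j μ Y κ′ u′)`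
— TODAY's `CubicSectorLevelDown.slotSum_gaugeLeg_e3OfK_ff` at the Lagrange member, §2 for the inner pairing, and ONE Fubini step `(u′, Y)` on the absolutely summable family
`(H_j h)(κ′,u′)·lamCoeffK_j μ Y κ′ u′·T_j(μ,Y)` (the response summable along every direction, the coefficients decaying from `Lc•Y`, the table bounded).  The weight `cΛ·wΛ_j` of this
member inside `SrecAt j`, the closed form of the slot weights ((ε-Λ) §2) and their vanishing against `T_j` for two-level data ((ε-Λ) §3) are NOT here (PART B). -/
theorem lambdaSector_slotSum_eq (hr : r ∈ box (d + 1) Lc) (j : ℕ)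
    {h : Form1 (d + 1) ℝ} (hh : ∀ l, Summable (h l)) {n : Form1 (d + 1) ℝ} {Bn : ℝ} (hn : ∀ κ u, |n κ u| ≤ Bn)
    {φ : Site (d + 1) → ℝ} {Bφ : ℝ} (hφ : ∀ y, |φ y| ≤ Bφ) :
    ∑ l, ∑' t : Site (d + 1), h l t * ∑' ux : Site (d + 1) × Site (d + 1), ∑ κ, ∑ κ₂, n κ ux.1 * dz φ κ₂ ux.2 *
        e3OfK Lc (coDressKBmAt (toSite r) Lc (KInvStep (d := d) Lc j))
          (SLam Lc (lamCoeffK (KInvStep (d := d) Lc j) (E2 d Lc j) Lc) (fun μ y => hessFFAt (toSite r) Lc μ y)) l t ux.1 ux.2 (Sum.inl κ) (Sum.inl κ₂)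
      = -((stepScale d Lc j * (Lc : ℝ) ^ (d + 1))⁻¹ *
        ∑' Y : Site (d + 1), ∑ μ : Fin (d + 1),
          (∑' y : Site (d + 1), ∑ κ'' : Fin (d + 1),
            (∑ κ, ∑' u : Site (d + 1), n κ u * colH (coDressKBmAt (toSite r) Lc (KInvStep (d := d) Lc j)) Lc κ u κ'' y)
              * (∑' w : Site (d + 1), ∑ a : Fin (d + 1), hessFFAt (toSite r) Lc μ Y y w (Sum.inl κ'') (Sum.inl a) * dz (fun x => φ (blk Lc x)) a w))
          * (∑' u' : Site (d + 1), ∑ κ' : Fin (d + 1),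
            (∑ l, ∑' t : Site (d + 1), h l t * colH (coDressKBmAt (toSite r) Lc (KInvStep (d := d) Lc j)) Lc l t κ' u')
              * lamCoeffK (KInvStep (d := d) Lc j) (E2 d Lc j) Lc μ Y κ' u')) := by
  classical
  have hLc : 1 ≤ Lc := one_le_of_neZero Lc
  set cH : ℝ := (stepScale d Lc j * (Lc : ℝ) ^ (d + 1))⁻¹ with hcH
  set Hh : Fin (d + 1) → Site (d + 1) → ℝ := fun κ' u' => ∑ l, ∑' t : Site (d + 1), h l t * colH (coDressKBmAt (toSite r) Lc (KInvStep (d := d) Lc j)) Lc l t κ' u' with hHh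
  set T : Fin (d + 1) → Site (d + 1) → ℝ := fun μ Y => ∑' y : Site (d + 1), ∑ κ'' : Fin (d + 1),
      (∑ κ, ∑' u : Site (d + 1), n κ u * colH (coDressKBmAt (toSite r) Lc (KInvStep (d := d) Lc j)) Lc κ u κ'' y)
        * (∑' w : Site (d + 1), ∑ a : Fin (d + 1), hessFFAt (toSite r) Lc μ Y y w (Sum.inl κ'') (Sum.inl a) * dz (fun x => φ (blk Lc x)) a w) with hT
  set lam : Fin (d + 1) → Site (d + 1) → Fin (d + 1) → Site (d + 1) → ℝ := fun μ Y κ' u' => lamCoeffK (KInvStep (d := d) Lc j) (E2 d Lc j) Lc μ Y κ' u' with hlam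
  -- the member is local and field–field: CubicSectorLevelDown §2 applies
  obtain ⟨Cs, δs, hδs, hS⟩ := locStencil_SLam_lamCoeffK (d := d) hr j
  have h0 := slotSum_gaugeLeg_e3OfK_ff hr j hS hδs
    (fun κ' u' y w m a => SLam_hessFFAt_inr_inl_eq_zero _ (toSite r) Lc κ' u' y w m a) hh hn hφ
  rw [h0]
  -- the inner pairing per slot (§2)
  have hI : ∀ κ' u', (∑' yw : Site (d + 1) × Site (d + 1), ∑ κ'' : Fin (d + 1), ∑ a : Fin (d + 1),
      (∑ κ, ∑' u : Site (d + 1), n κ u * colH (coDressKBmAt (toSite r) Lc (KInvStep (d := d) Lc j)) Lc κ u κ'' yw.1) * dz (fun x => φ (blk Lc x)) a yw.2 *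
        SLam Lc (lamCoeffK (KInvStep (d := d) Lc j) (E2 d Lc j) Lc) (fun μ y => hessFFAt (toSite r) Lc μ y) κ' u' yw.1 yw.2 (Sum.inl κ'') (Sum.inl a))
      = -∑ μ : Fin (d + 1), ∑' Y : Site (d + 1), lam μ Y κ' u' * T μ Y := fun κ' u' =>
    innerPairing_SLam_eq hr j hn hφ κ' u'
  simp only [hI]
  -- bounds: the response is summable along every direction, the coefficients decay, the table is bounded
  obtain ⟨Cl, δl, hδl, hCl, hlamb⟩ := exists_abs_lamCoeffK_le (d := d) (Lc := Lc) j
  obtain ⟨BT, hBT0, hTb⟩ := abs_lambdaTable_le (d := d) hr j hn hφ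
  have hTb' : ∀ μ Y, |T μ Y| ≤ BT := fun μ Y => hTb μ Y
  have hHs : ∀ κ', Summable fun u' : Site (d + 1) => Hh κ' u' := fun κ' => summable_fieldResponse hr j hh κ'
  -- the absolutely summable family `(u′, Y) ↦ Hh κ′ u′·(lam μ Y κ′ u′·T μ Y)`, per `(κ′, μ)`
  set E : ℝ := Real.exp (δl * ((Lc : ℝ) * (d + 1))) * Zl (d + 1) δl with hE
  have hF : ∀ κ' μ, Summable (Function.uncurry fun (u' : Site (d + 1)) (Y : Site (d + 1)) => Hh κ' u' * (lam μ Y κ' u' * T μ Y)) := by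
    intro κ' μ
    have hg0 : ∀ p : Site (d + 1) × Site (d + 1), 0 ≤ |Hh κ' p.1| * (Cl * Real.exp (-δl * l1 ((Lc : ℤ) • p.2 - p.1)) * BT) := fun p => by positivity
    have hfib : ∀ u' : Site (d + 1), Summable fun Y : Site (d + 1) => |Hh κ' u'| * (Cl * Real.exp (-δl * l1 ((Lc : ℤ) • Y - u')) * BT) := fun u' =>
      (((summable_exp_coarse (d := d) (one_le_of_neZero Lc) hδl u').mul_left Cl).mul_right BT).mul_left _
    have hmarg : Summable fun u' : Site (d + 1) => ∑' Y : Site (d + 1), |Hh κ' u'| * (Cl * Real.exp (-δl * l1 ((Lc : ℤ) • Y - u')) * BT) := by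
      have hle : ∀ u' : Site (d + 1), (∑' Y : Site (d + 1), |Hh κ' u'| * (Cl * Real.exp (-δl * l1 ((Lc : ℤ) • Y - u')) * BT)) ≤ |Hh κ' u'| * (Cl * E * BT) := by
        intro u'
        rw [tsum_mul_left, tsum_mul_right, tsum_mul_left]
        have hc : (∑' Y : Site (d + 1), Real.exp (-δl * l1 ((Lc : ℤ) • Y - u'))) ≤ E := by
          have h1 := tsum_exp_coarse_le' (d := d) Lc hδl u'
          rw [hE]
          exact le_trans (le_of_eq (tsum_congr fun Y => by rw [l1_sub_symm])) h1
        have h2 : Cl * (∑' Y : Site (d + 1), Real.exp (-δl * l1 ((Lc : ℤ) • Y - u'))) * BT ≤ Cl * E * BT :=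
          mul_le_mul_of_nonneg_right (mul_le_mul_of_nonneg_left hc hCl) hBT0
        exact mul_le_mul_of_nonneg_left h2 (abs_nonneg _)
      exact Summable.of_nonneg_of_le (fun u' => tsum_nonneg fun Y => hg0 (u', Y)) hle ((hHs κ').abs.mul_right _)
    have hgs : Summable fun p : Site (d + 1) × Site (d + 1) => |Hh κ' p.1| * (Cl * Real.exp (-δl * l1 ((Lc : ℤ) • p.2 - p.1)) * BT) :=
      (summable_prod_of_nonneg hg0).2 ⟨hfib, hmarg⟩
    refine Summable.of_norm_bounded hgs (fun p => ?_)
    obtain ⟨u', Y⟩ := p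
    rw [Real.norm_eq_abs, Function.uncurry_apply_pair, abs_mul, abs_mul]
    exact mul_le_mul_of_nonneg_left (mul_le_mul (hlamb μ Y κ' u') (hTb' μ Y) (abs_nonneg _) (by positivity)) (abs_nonneg _)
  have hs_u : ∀ κ' μ, Summable fun u' : Site (d + 1) => ∑' Y : Site (d + 1), Hh κ' u' * (lam μ Y κ' u' * T μ Y) := fun κ' μ => by
    simpa only [Function.uncurry_apply_pair] using (hF κ' μ).prod
  have hs_Y : ∀ κ' μ, Summable fun Y : Site (d + 1) => ∑' u' : Site (d + 1), Hh κ' u' * (lam μ Y κ' u' * T μ Y) := fun κ' μ => by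
    simpa only [Function.uncurry_apply_pair, Prod.swap_prod_mk] using (hF κ' μ).prod_symm.prod
  -- LHS: `cH·Σ_κ′ Σ'_{u′} Hh·(−Σ_μ Σ'_Y lam·T)`; reorganise
  have e1 : ∀ κ', (∑' u' : Site (d + 1), Hh κ' u' * -∑ μ : Fin (d + 1), ∑' Y : Site (d + 1), lam μ Y κ' u' * T μ Y)
      = -∑ μ : Fin (d + 1), ∑' Y : Site (d + 1), ∑' u' : Site (d + 1), Hh κ' u' * (lam μ Y κ' u' * T μ Y) := by
    intro κ'
    have e : ∀ u' : Site (d + 1), Hh κ' u' * -∑ μ : Fin (d + 1), ∑' Y : Site (d + 1), lam μ Y κ' u' * T μ Y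
        = -∑ μ : Fin (d + 1), ∑' Y : Site (d + 1), Hh κ' u' * (lam μ Y κ' u' * T μ Y) := fun u' => by
      rw [mul_neg, Finset.mul_sum, neg_inj]
      refine Finset.sum_congr rfl fun μ _ => ?_
      rw [tsum_mul_left]
    calc (∑' u' : Site (d + 1), Hh κ' u' * -∑ μ : Fin (d + 1), ∑' Y : Site (d + 1), lam μ Y κ' u' * T μ Y)
        = ∑' u' : Site (d + 1), -∑ μ : Fin (d + 1), ∑' Y : Site (d + 1), Hh κ' u' * (lam μ Y κ' u' * T μ Y) := tsum_congr e
      _ = -∑' u' : Site (d + 1), ∑ μ : Fin (d + 1), ∑' Y : Site (d + 1), Hh κ' u' * (lam μ Y κ' u' * T μ Y) := tsum_neg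
      _ = -∑ μ : Fin (d + 1), ∑' u' : Site (d + 1), ∑' Y : Site (d + 1), Hh κ' u' * (lam μ Y κ' u' * T μ Y) := by
          rw [Summable.tsum_finsetSum (fun μ _ => hs_u κ' μ)]
      _ = -∑ μ : Fin (d + 1), ∑' Y : Site (d + 1), ∑' u' : Site (d + 1), Hh κ' u' * (lam μ Y κ' u' * T μ Y) :=
          congrArg Neg.neg (Finset.sum_congr rfl fun μ _ => ((hF κ' μ).tsum_comm).symm)
  have e2 : (cH * ∑ κ' : Fin (d + 1), ∑' u' : Site (d + 1), Hh κ' u' * -∑ μ : Fin (d + 1), ∑' Y : Site (d + 1), lam μ Y κ' u' * T μ Y)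
      = -(cH * ∑ μ : Fin (d + 1), ∑ κ' : Fin (d + 1), ∑' Y : Site (d + 1), ∑' u' : Site (d + 1), Hh κ' u' * (lam μ Y κ' u' * T μ Y)) := by
    rw [Finset.sum_congr rfl fun κ' _ => e1 κ', Finset.sum_neg_distrib, mul_neg, Finset.sum_comm]
  refine e2.trans ?_
  rw [neg_inj]
  refine congrArg (cH * ·) ?_
  have e3 : ∀ μ : Fin (d + 1), (∑ κ' : Fin (d + 1), ∑' Y : Site (d + 1), ∑' u' : Site (d + 1), Hh κ' u' * (lam μ Y κ' u' * T μ Y))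
      = ∑' Y : Site (d + 1), ∑ κ' : Fin (d + 1), ∑' u' : Site (d + 1), Hh κ' u' * (lam μ Y κ' u' * T μ Y) := fun μ =>
    (Summable.tsum_finsetSum (fun κ' _ => hs_Y κ' μ)).symm
  rw [Finset.sum_congr rfl fun μ _ => e3 μ, ← Summable.tsum_finsetSum (fun μ _ => summable_sum fun κ' _ => hs_Y κ' μ)]
  refine tsum_congr fun Y => ?_
  refine Finset.sum_congr rfl fun μ _ => ?_
  -- `Σ_κ′ Σ'_{u′} Hh·(lam·T) = T·Σ'_{u′} Σ_κ′ Hh·lam`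
  have hs2 : ∀ κ', Summable fun u' : Site (d + 1) => Hh κ' u' * lam μ Y κ' u' := fun κ' =>
    (summable_bdd_mul (hHs κ') (fun u' => (hlamb μ Y κ' u').trans
      (mul_le_of_le_one_right hCl (by rw [Real.exp_le_one_iff]; have := l1_nonneg ((Lc : ℤ) • Y - u'); nlinarith)))).congr fun u' => by ring
  rw [Summable.tsum_finsetSum (fun κ' _ => hs2 κ'), Finset.mul_sum]
  refine Finset.sum_congr rfl fun κ' _ => ?_
  rw [← tsum_mul_left]
  refine tsum_congr fun u' => ?_
  simp only [hlam]
  ring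

end Step

end Summit.QuantumFields.BalabanUV.Beta.GAN24.LambdaSectorSlotSum

end
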